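import Mathlib
import HarnessLib
import Summits.HubbardSuperconductivity.HubbardSuperconductivity.Theorems.KLProgrammePerturbedFermiCurveCausticPackage

/-!
# Route `KLProgramme` — ENGINE child (stmt-HubbardSuperconductivity-20437 `KLRegimeEngineV17F2`): the caustic-regime packages with constants chosen UNIFORMLY in
# the frame (step (T3d) preparation; design note HOME/hubbard-kl-k3c2-p2/TWO-SHELL-FRAME-PORT.md §10)

Cell `gate-hubbard-kl`, seat hubbard-kl-k3c2-p2 g15.  `window_convexity_const_frame` and `exists_away_bound_frame` (…CausticPackage) with the quantifiers reordered:
the constants are produced from `(B, κ₁, Kc, r₀, g₀, w, η⋆, v)` alone and THEN hold for every frame `K`, every `μ` with `GeomConstants (frameLevel μ K) Kc r₀ g₀ w`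
and every frame-shift of sizes `≤ κ₀, κ₁` (**`window_convexity_const_uniform`**, **`exists_away_bound_uniform`**).  Same proofs.
Everything is PROVED; no definitions, no named facts; nothing asserts any stub or superconductivity.
References: DECOMP App. E Lemma E.3; FST II App. B [cite: FeldmanSalmhoferTrubowitz1998]; BGM 2006 §2.7 [cite: BenfattoGiulianiMastropietro2006].
-/

noncomputable section

namespace Summit.HubbardSuperconductivity.HubbardSuperconductivity.Theorems.PerturbedFermiCurve

set_option linter.dupNamespace false -- summit = problem name (single-conjunct summit), D-0017

open Real Set MeasureTheory
open scoped ENNReal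
open Literature.MathematicalPhysics.QuantumLattice Literature.MathematicalPhysics.QuantumLattice.BandSectorCounting
open Literature.MathematicalPhysics.QuantumLattice.FermiRG
open Summit.HubbardSuperconductivity.HubbardSuperconductivity.Theorems.DispersionFlow
open Summit.HubbardSuperconductivity.HubbardSuperconductivity.Theorems.KLRegimeSplit

/-- **The window convexity constant, uniformly in the frame**: `ρ⋆ > 0` from `(B, κ₁, Kc, g₀, w, r₀)` alone such that for every frame `K`, `μ` with
`GeomConstants (frameLevel μ K) Kc r₀ g₀ w`, sizes `≤ κ₀, κ₁`, every admissible `ν` with `|ν − μ| ≤ r₀/2`, `ρ ≤ ρ⋆` and every angle whose `2p(θ) − w⃗` is `ρ`-close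
to `2πm`: `w·u_min² ≤ G″(θ)`. [cite: FeldmanSalmhoferTrubowitz1998, Lemma 2.1] -/
theorem window_convexity_const_uniform {a b : ℝ} (B : BandBounds a b) {κ₀ κ₁ Kc r₀ g₀ w : ℝ} (hκ₁0 : 0 ≤ κ₁) (hκ₁ : κ₁ < B.Dtmin)
    (hKc : 0 ≤ Kc) (hr₀ : 0 < r₀) (hg₀ : 0 < g₀) (hw : 0 < w) :
    ∃ ρs : ℝ, 0 < ρs ∧ ∀ (K : TrigPolyC4v) (μ : ℝ),
        (∀ k : Fin 2 → ℝ, (∀ i, |k i| ≤ π) → |(fun k : Fin 2 → ℝ => -K.eval k) k| ≤ κ₀) →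
        (∀ k : Fin 2 → ℝ, (∀ i, |k i| ≤ π) → ‖fderiv ℝ (fun k : Fin 2 → ℝ => -K.eval k) k‖ ≤ κ₁) →
        GeomConstants (frameLevel μ K) Kc r₀ g₀ w →
      ∀ ν : ℝ, a ≤ ν - κ₀ → ν + κ₀ ≤ b → |ν - μ| ≤ r₀ / 2 →
      ∀ (ρ : ℝ) (wv : Fin 2 → ℝ) (m : Fin 2 → ℤ) (θ : ℝ), ρ ≤ ρs →
        (∀ i, |2 * (perturbedFermiRadius (fun k : Fin 2 → ℝ => -K.eval k) ν θ • dir θ) i - wv i - m i * (2 * π)| ≤ ρ) →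
        w * B.umin ^ 2 ≤
          fderiv ℝ (fderiv ℝ (frameLevel μ K)) (WithLp.toLp 2 (perturbedFermiRadius (fun k : Fin 2 → ℝ => -K.eval k) ν θ • dir θ - wv))
              (WithLp.toLp 2 ![VXE (perturbedFermiRadius (fun k : Fin 2 → ℝ => -K.eval k) ν) θ, VYE (perturbedFermiRadius (fun k : Fin 2 → ℝ => -K.eval k) ν) θ])
              (WithLp.toLp 2 ![VXE (perturbedFermiRadius (fun k : Fin 2 → ℝ => -K.eval k) ν) θ, VYE (perturbedFermiRadius (fun k : Fin 2 → ℝ => -K.eval k) ν) θ]) +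
            fderiv ℝ (frameLevel μ K) (WithLp.toLp 2 (perturbedFermiRadius (fun k : Fin 2 → ℝ => -K.eval k) ν θ • dir θ - wv))
              (WithLp.toLp 2 ![deriv (deriv (perturbedFermiRadius (fun k : Fin 2 → ℝ => -K.eval k) ν)) θ * Real.cos θ -
                    2 * deriv (perturbedFermiRadius (fun k : Fin 2 → ℝ => -K.eval k) ν) θ * Real.sin θ -
                    perturbedFermiRadius (fun k : Fin 2 → ℝ => -K.eval k) ν θ * Real.cos θ,
                  deriv (deriv (perturbedFermiRadius (fun k : Fin 2 → ℝ => -K.eval k) ν)) θ * Real.sin θ +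
                    2 * deriv (perturbedFermiRadius (fun k : Fin 2 → ℝ => -K.eval k) ν) θ * Real.cos θ -
                    perturbedFermiRadius (fun k : Fin 2 → ℝ => -K.eval k) ν θ * Real.sin θ]) := by
  have hπ := Real.pi_pos
  have hsm := B.smax_pos
  have hDt := B.Dtmin_pos
  have hum := B.umin_pos
  obtain ⟨D, hD⟩ : ∃ x : ℝ, x = B.Dtmin - κ₁ := ⟨_, rfl⟩
  have hD0 : 0 < D := by rw [hD]; exact sub_pos.2 hκ₁
  obtain ⟨SE, hSE⟩ : ∃ x : ℝ, x = B.smax + κ₁ * (π * Real.sqrt 2 + 2 * B.smax) / (B.Dtmin - κ₁) := ⟨_, rfl⟩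
  have hSE0 : 0 < SE := by rw [hSE, ← hD]; positivity
  obtain ⟨U1, hU1⟩ : ∃ x : ℝ, x = (4 + κ₁) * (π * Real.sqrt 2) / (B.Dtmin - κ₁) := ⟨_, rfl⟩
  have hU10 : 0 < U1 := by rw [hU1, ← hD]; positivity
  obtain ⟨AE, hAE⟩ : ∃ x : ℝ, x = (2 * Kc * SE ^ 2 + (8 + 2 * κ₁) * U1 + (4 + κ₁) * (π * Real.sqrt 2)) / (B.Dtmin - κ₁) + 2 * U1 + π * Real.sqrt 2 := ⟨_, rfl⟩
  have hAE0 : 0 < AE := by rw [hAE, ← hD]; positivity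
  obtain ⟨P, hP⟩ : ∃ x : ℝ, x = (w + Kc) * (2 * Kc * SE / g₀) ^ 2 := ⟨_, rfl⟩
  have hP0 : 0 ≤ P := by rw [hP]; positivity
  obtain ⟨Q, hQ⟩ : ∃ x : ℝ, x = 4 * Real.sqrt 2 * Kc ^ 2 * SE ^ 2 / g₀ + Real.sqrt 2 * Kc * AE := ⟨_, rfl⟩
  have hQ0 : 0 ≤ Q := by rw [hQ]; positivity
  -- the error term of `transCurve_second_deriv_ge_on_window` is `ρ²P + ρQ`
  have hEform : ∀ ρ : ℝ,
      (w + Kc) * (Kc * (Real.sqrt 2 * ρ) * (Real.sqrt 2 * SE) / g₀) ^ 2 +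
          2 * Kc * (Real.sqrt 2 * SE) * (Kc * (Real.sqrt 2 * ρ) * (Real.sqrt 2 * SE) / g₀) + Kc * (Real.sqrt 2 * ρ) * AE =
        ρ ^ 2 * P + ρ * Q := by
    intro ρ
    have h2 : Real.sqrt 2 * Real.sqrt 2 = 2 := by rw [← sq, Real.sq_sqrt (by norm_num : (0:ℝ) ≤ 2)]
    rw [hP, hQ]
    field_simp
    ring_nf
    rw [show Real.sqrt 2 ^ 4 = (Real.sqrt 2 ^ 2) ^ 2 by ring, Real.sq_sqrt (by norm_num : (0:ℝ) ≤ 2)]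
    rw [show Real.sqrt 2 ^ 3 = Real.sqrt 2 ^ 2 * Real.sqrt 2 by ring, Real.sq_sqrt (by norm_num : (0:ℝ) ≤ 2)]
    ring
  obtain ⟨ρs, hρs⟩ : ∃ x : ℝ, x = min (min 1 (w * B.umin ^ 2 / (P + Q + 1))) (r₀ / (2 * (Kc * Real.sqrt 2) + 1) / 2) := ⟨_, rfl⟩
  have hρs0 : 0 < ρs := by rw [hρs]; exact lt_min (lt_min one_pos (by positivity)) (by positivity)
  refine ⟨ρs, hρs0, ?_⟩
  intro K μ hδ hκ hG ν hlo hhi hνμ ρ wv m θ hρle hwin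
  have hρ0 : 0 ≤ ρ := (abs_nonneg _).trans (hwin 0)
  have hρ1 : ρ ≤ 1 := hρle.trans (by rw [hρs]; exact (min_le_left _ _).trans (min_le_left _ _))
  have hρ2 : ρ ≤ w * B.umin ^ 2 / (P + Q + 1) := hρle.trans (by rw [hρs]; exact (min_le_left _ _).trans (min_le_right _ _))
  have hρ3 : ρ ≤ r₀ / (2 * (Kc * Real.sqrt 2) + 1) / 2 := hρle.trans (by rw [hρs]; exact min_le_right _ _)
  -- the tube condition
  have hνρ : |ν - μ| + Kc * (Real.sqrt 2 * ρ) < r₀ := by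
    have h1 : Kc * (Real.sqrt 2 * ρ) ≤ (Kc * Real.sqrt 2) * (r₀ / (2 * (Kc * Real.sqrt 2) + 1) / 2) := by
      rw [← mul_assoc]; exact mul_le_mul_of_nonneg_left hρ3 (by positivity)
    have h2 : (Kc * Real.sqrt 2) * (r₀ / (2 * (Kc * Real.sqrt 2) + 1) / 2) < r₀ / 2 := by
      rw [show (Kc * Real.sqrt 2) * (r₀ / (2 * (Kc * Real.sqrt 2) + 1) / 2) = (Kc * Real.sqrt 2) / (2 * (Kc * Real.sqrt 2) + 1) * r₀ / 2 by ring]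
      have h3 : (Kc * Real.sqrt 2) / (2 * (Kc * Real.sqrt 2) + 1) < 1 := by
        rw [div_lt_one (by positivity)]; have : 0 ≤ Kc * Real.sqrt 2 := by positivity
        linarith
      have := mul_lt_mul_of_pos_right h3 hr₀
      linarith
    linarith
  have hνlt : |ν - μ| < r₀ := by linarith [hνμ]
  have hδc : Continuous (fun k : Fin 2 → ℝ => -K.eval k) := (contDiff_frameShift_toLp K (m := 0)).continuous
  have hu : ∀ θ, IsBandFermiRadius (ν - (fun k : Fin 2 → ℝ => -K.eval k) (perturbedFermiRadius (fun k : Fin 2 → ℝ => -K.eval k) ν θ • dir θ)) θ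
      (perturbedFermiRadius (fun k : Fin 2 → ℝ => -K.eval k) ν θ) := isBandFermiRadius_perturbedFermiRadius B hδc hδ hlo hhi
  have hmain := transCurve_second_deriv_ge_on_window B hδ hlo hhi hκ hκ₁ hu hG hνlt θ wv m hwin hνρ
  rw [← hSE, ← hU1, ← hAE, hEform ρ] at hmain
  -- `ρ²P + ρQ ≤ w u_min²`
  have herr : ρ ^ 2 * P + ρ * Q ≤ w * B.umin ^ 2 := by
    have h1 : ρ ^ 2 * P ≤ ρ * P := by
      have : ρ ^ 2 ≤ ρ := by nlinarith only [hρ0, hρ1]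
      exact mul_le_mul_of_nonneg_right this hP0
    have h2 : ρ * (P + Q + 1) ≤ w * B.umin ^ 2 := by
      rw [le_div_iff₀ (by positivity)] at hρ2; exact hρ2
    nlinarith only [h1, h2, hρ0, hP0, hQ0]
  linarith only [hmain, herr]

/-- **Lemmas E.1/E.3 away from the Cooper point, uniformly in the frame**: `δ₁, C₁, C₂` from `(B, κ₁, Kc, r₀, g₀, w, η⋆, v)` alone; then for every frame `K`,
`μ` with `GeomConstants (frameLevel μ K) Kc r₀ g₀ w`, sizes `≤ κ₀, κ₁`, every admissible `ν` (`|ν − μ| ≤ r₀/2`), `0 < δ ≤ δ₁` and every transfer at torus sup-distance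
`≥ v` from `2πℤ²`: `vol ≤ C₁δ + C₂√δ`. [cite: FeldmanSalmhoferTrubowitz1998, App. B] -/
theorem exists_away_bound_uniform {a b : ℝ} (B : BandBounds a b) {κ₀ κ₁ Kc r₀ g₀ w ηs vS : ℝ} (hκ₁0 : 0 ≤ κ₁) (hκ₁ : κ₁ < B.Dtmin)
    (hKc : 0 ≤ Kc) (hr₀ : 0 < r₀) (hg₀ : 0 < g₀) (hw : 0 < w) (hηs : 0 < ηs) (hvS : 0 < vS) :
    ∃ δ₁ C₁ C₂ : ℝ, 0 < δ₁ ∧ 0 < C₁ ∧ 0 < C₂ ∧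
      ∀ (K : TrigPolyC4v) (μ : ℝ),
        (∀ k : Fin 2 → ℝ, (∀ i, |k i| ≤ π) → |(fun k : Fin 2 → ℝ => -K.eval k) k| ≤ κ₀) →
        (∀ k : Fin 2 → ℝ, (∀ i, |k i| ≤ π) → ‖fderiv ℝ (fun k : Fin 2 → ℝ => -K.eval k) k‖ ≤ κ₁) →
        GeomConstants (frameLevel μ K) Kc r₀ g₀ w →
      ∀ ν : ℝ, a + ηs ≤ ν - κ₀ → ν + κ₀ ≤ b - ηs → |ν - μ| ≤ r₀ / 2 →
        ∀ (δ : ℝ) (wv : Fin 2 → ℝ) (θ₀ : ℝ), 0 < δ → δ ≤ δ₁ → (∀ m : Fin 2 → ℤ, ∃ i, vS ≤ |wv i + m i * (2 * π)|) →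
          volume {θ ∈ Icc θ₀ (θ₀ + 2 * π) |
              |sqDispersion (perturbedFermiRadius (fun k : Fin 2 → ℝ => -K.eval k) ν θ • dir θ - wv) +
                  -K.eval (perturbedFermiRadius (fun k : Fin 2 → ℝ => -K.eval k) ν θ • dir θ - wv) - ν| ≤ δ} ≤
            ENNReal.ofReal (C₁ * δ + C₂ * Real.sqrt δ) := by
  have hπ := Real.pi_pos
  have hsm := B.smax_pos
  have hDt := B.Dtmin_pos
  have hum := B.umin_pos
  obtain ⟨D, hD⟩ : ∃ x : ℝ, x = B.Dtmin - κ₁ := ⟨_, rfl⟩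
  have hD0 : 0 < D := by rw [hD]; exact sub_pos.2 hκ₁
  obtain ⟨SE, hSE⟩ : ∃ x : ℝ, x = B.smax + κ₁ * (π * Real.sqrt 2 + 2 * B.smax) / (B.Dtmin - κ₁) := ⟨_, rfl⟩
  have hSE0 : 0 < SE := by rw [hSE, ← hD]; positivity
  obtain ⟨A1, hA1⟩ : ∃ x : ℝ, x = B.smax * B.Dtmin * (π / 2) * (4 + κ₁) / (D ^ 2 * B.umin ^ 2 * w) := ⟨_, rfl⟩
  have hA10 : 0 < A1 := by rw [hA1]; positivity
  obtain ⟨Bη, hBη⟩ : ∃ x : ℝ, x = 1 / D + B.smax * B.Dtmin * π * Kc * (4 + κ₁) / (D ^ 3 * B.umin * w) := ⟨_, rfl⟩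
  have hBη0 : 0 < Bη := by rw [hBη]; positivity
  have hRform : ∀ Λ η : ℝ, (η + B.smax * B.Dtmin *
      ((π / 2 * Λ / ((B.Dtmin - κ₁) * B.umin) + π * Kc * η / (B.Dtmin - κ₁) ^ 2) * (4 + κ₁) / (B.umin * w))) / (B.Dtmin - κ₁) =
      A1 * Λ + Bη * η := by
    intro Λ η
    rw [hA1, hBη, ← hD]
    field_simp
    ring
  have hRform0 : ∀ η : ℝ, (η + B.smax * B.Dtmin * ((π * Kc * η / (B.Dtmin - κ₁) ^ 2) * (4 + κ₁) / (B.umin * w))) / (B.Dtmin - κ₁) = Bη * η := by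
    intro η
    rw [hBη, ← hD]
    field_simp
  obtain ⟨Msl, hMsl⟩ : ∃ x : ℝ, x = Kc * (Real.sqrt 2 * SE) + 1 := ⟨_, rfl⟩
  have hMsl0 : 0 < Msl := by rw [hMsl]; positivity
  obtain ⟨κW, hκW⟩ : ∃ x : ℝ, x = 1 + 2 * SE * (π / (Real.sqrt 2 * B.umin)) := ⟨_, rfl⟩
  have hκW1 : 1 ≤ κW := by
    have h0 : 0 ≤ 2 * SE * (π / (Real.sqrt 2 * B.umin)) := by positivity
    rw [hκW]; linarith only [h0]
  have hκW0 : 0 < κW := one_pos.trans_le hκW1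
  -- the convexity threshold
  obtain ⟨ρs, hρs0, hconv⟩ := window_convexity_const_uniform B (κ₀ := κ₀) hκ₁0 hκ₁ hKc hr₀ hg₀ hw
  -- the master scale `q`
  obtain ⟨q, hq⟩ : ∃ x : ℝ, x = min (min vS (ρs / κW)) (min (Bη * ηs) (min (Real.sqrt 2 * B.umin) π)) := ⟨_, rfl⟩
  have hq0 : 0 < q := by rw [hq]; exact lt_min (lt_min hvS (by positivity)) (lt_min (by positivity) (lt_min (by positivity) hπ))
  have hq1 : q ≤ vS := by rw [hq]; exact (min_le_left _ _).trans (min_le_left _ _)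
  have hq2 : q ≤ ρs / κW := by rw [hq]; exact (min_le_left _ _).trans (min_le_right _ _)
  have hq3 : q ≤ Bη * ηs := by rw [hq]; exact (min_le_right _ _).trans (min_le_left _ _)
  have hq4 : q ≤ Real.sqrt 2 * B.umin := by rw [hq]; exact (min_le_right _ _).trans ((min_le_right _ _).trans (min_le_left _ _))
  have hq5 : q ≤ π := by rw [hq]; exact (min_le_right _ _).trans ((min_le_right _ _).trans (min_le_right _ _))
  -- the parameters
  obtain ⟨lam, hlam⟩ : ∃ x : ℝ, x = q / (16 * A1) := ⟨_, rfl⟩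
  have hlam0 : 0 < lam := by rw [hlam]; positivity
  obtain ⟨η, hη⟩ : ∃ x : ℝ, x = q / (8 * Bη) := ⟨_, rfl⟩
  have hη0 : 0 < η := by rw [hη]; positivity
  obtain ⟨ℓ, hℓ⟩ : ∃ x : ℝ, x = min (η / Msl) (q / (16 * SE)) := ⟨_, rfl⟩
  have hℓ0 : 0 < ℓ := by rw [hℓ]; exact lt_min (by positivity) (by positivity)
  obtain ⟨ρ₂, hρ₂⟩ : ∃ x : ℝ, x = q / 2 := ⟨_, rfl⟩
  have hρ₂0 : 0 < ρ₂ := by rw [hρ₂]; positivity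
  obtain ⟨δ₁, hδ₁⟩ : ∃ x : ℝ, x = min η (min (4 * π * lam) (q * lam / (4 * SE + 4))) := ⟨_, rfl⟩
  have hδ₁0 : 0 < δ₁ := by rw [hδ₁]; exact lt_min hη0 (lt_min (by positivity) (by positivity))
  obtain ⟨c, hc⟩ : ∃ x : ℝ, x = w * B.umin ^ 2 := ⟨_, rfl⟩
  have hc0 : 0 < c := by rw [hc]; positivity
  obtain ⟨C₁, hC₁⟩ : ∃ x : ℝ, x = 3 * (2 * π / ℓ + 97) / lam := ⟨_, rfl⟩
  have hC₁0 : 0 < C₁ := by rw [hC₁]; positivity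
  obtain ⟨C₂, hC₂⟩ : ∃ x : ℝ, x = 48 * 6 / Real.sqrt c := ⟨_, rfl⟩
  have hC₂0 : 0 < C₂ := by rw [hC₂]; positivity
  -- key values
  have hA1lam : A1 * (2 * lam) = q / 8 := by rw [hlam]; field_simp; ring
  have hBηη : Bη * η = q / 8 := by rw [hη]; field_simp
  have hηle : η ≤ ηs / 8 := by
    rw [hη, div_le_iff₀ (by positivity)]; linarith only [hq3]
  refine ⟨δ₁, C₁, C₂, hδ₁0, hC₁0, hC₂0, ?_⟩
  intro K μ hδ hκ hG ν hνlo hνhi hνμ δ wv θ₀ hδ0 hδle htor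
  have hνlt : |ν - μ| < r₀ := by linarith only [hνμ, hr₀]
  have hδη : δ ≤ η := hδle.trans (by rw [hδ₁]; exact min_le_left _ _)
  have hδl' : δ ≤ 4 * π * lam := hδle.trans (by rw [hδ₁]; exact (min_le_right _ _).trans (min_le_left _ _))
  have hδq : δ ≤ q * lam / (4 * SE + 4) := hδle.trans (by rw [hδ₁]; exact (min_le_right _ _).trans (min_le_right _ _))
  -- hypotheses of the caustic lemma
  have hlo : a ≤ ν - κ₀ - η := by linarith only [hνlo, hηle, hηs]
  have hhi : ν + κ₀ + η ≤ b := by linarith only [hνhi, hηle, hηs]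
  have hδl : δ / (2 * lam) ≤ 2 * π := by rw [div_le_iff₀ (by positivity)]; linarith only [hδl']
  have hfar : ∀ m : Fin 2 → ℤ, ∃ i, vS / 2 < |wv i + m i * (2 * π)| := by
    intro m; obtain ⟨i, hi⟩ := htor m; exact ⟨i, by linarith only [hi, hvS]⟩
  have hR1 : (η + B.smax * B.Dtmin *
      ((π / 2 * (2 * lam) / ((B.Dtmin - κ₁) * B.umin) + π * Kc * η / (B.Dtmin - κ₁) ^ 2) * (4 + κ₁) / (B.umin * w))) / (B.Dtmin - κ₁) ≤ vS / 2 := by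
    rw [hRform, hA1lam, hBηη]; linarith only [hq1, hq0]
  have hSEδ : 2 * SE * (δ / (2 * lam)) ≤ q / 4 := by
    rw [show 2 * SE * (δ / (2 * lam)) = SE * δ / lam by field_simp]
    rw [div_le_iff₀ hlam0]
    have h1 : δ * (4 * SE + 4) ≤ q * lam := by rw [le_div_iff₀ (by positivity)] at hδq; exact hδq
    linarith only [h1, hδ0]
  have hρ₂a : (η + B.smax * B.Dtmin *
      ((π / 2 * (2 * lam) / ((B.Dtmin - κ₁) * B.umin) + π * Kc * η / (B.Dtmin - κ₁) ^ 2) * (4 + κ₁) / (B.umin * w))) / (B.Dtmin - κ₁) +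
      2 * (B.smax + κ₁ * (π * Real.sqrt 2 + 2 * B.smax) / (B.Dtmin - κ₁)) * (δ / (2 * lam)) ≤ ρ₂ := by
    rw [hRform, hA1lam, hBηη, ← hSE, hρ₂]; linarith only [hSEδ]
  have hℓ1 : ℓ ≤ η / Msl := by rw [hℓ]; exact min_le_left _ _
  have hℓ2 : ℓ ≤ q / (16 * SE) := by rw [hℓ]; exact min_le_right _ _
  have hηℓ : Kc * (Real.sqrt 2 * (B.smax + κ₁ * (π * Real.sqrt 2 + 2 * B.smax) / (B.Dtmin - κ₁))) * ℓ ≤ η := by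
    rw [← hSE]
    have h1 : Kc * (Real.sqrt 2 * SE) * ℓ ≤ Kc * (Real.sqrt 2 * SE) * (η / Msl) := mul_le_mul_of_nonneg_left hℓ1 (by positivity)
    have h2 : Kc * (Real.sqrt 2 * SE) * (η / Msl) ≤ η := by
      rw [show Kc * (Real.sqrt 2 * SE) * (η / Msl) = (Kc * (Real.sqrt 2 * SE)) / Msl * η by ring]
      have h3 : (Kc * (Real.sqrt 2 * SE)) / Msl ≤ 1 := by
        rw [div_le_one hMsl0, hMsl]; exact le_add_of_nonneg_right zero_le_one
      calc (Kc * (Real.sqrt 2 * SE)) / Msl * η ≤ 1 * η := mul_le_mul_of_nonneg_right h3 hη0.le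
        _ = η := one_mul η
    linarith only [h1, h2]
  have hR0 : (η + B.smax * B.Dtmin * ((π * Kc * η / (B.Dtmin - κ₁) ^ 2) * (4 + κ₁) / (B.umin * w))) / (B.Dtmin - κ₁) ≤ vS / 2 := by
    rw [hRform0, hBηη]; linarith only [hq1, hq0]
  have hρ₂c : (η + B.smax * B.Dtmin * ((π * Kc * η / (B.Dtmin - κ₁) ^ 2) * (4 + κ₁) / (B.umin * w))) / (B.Dtmin - κ₁) +
      2 * (B.smax + κ₁ * (π * Real.sqrt 2 + 2 * B.smax) / (B.Dtmin - κ₁)) * ℓ ≤ ρ₂ := by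
    rw [hRform0, hBηη, ← hSE, hρ₂]
    have : 2 * SE * ℓ ≤ 2 * SE * (q / (16 * SE)) := mul_le_mul_of_nonneg_left hℓ2 (by positivity)
    rw [show 2 * SE * (q / (16 * SE)) = q / 8 by field_simp; ring] at this
    linarith only [this, hq0]
  have hρ₂π : ρ₂ < 2 * π := by rw [hρ₂]; linarith only [hq5, hπ]
  have hσ : ρ₂ / (Real.sqrt 2 * B.umin) < 2 := by
    have h0 : 0 < Real.sqrt 2 * B.umin := by positivity
    rw [div_lt_iff₀ h0, hρ₂]; linarith only [hq4, h0]
  -- window convexity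
  have hlo' : a ≤ ν - κ₀ := by linarith only [hνlo, hηs]
  have hhi' : ν + κ₀ ≤ b := by linarith only [hνhi, hηs]
  have hρwin : ρ₂ + 2 * (B.smax + κ₁ * (π * Real.sqrt 2 + 2 * B.smax) / (B.Dtmin - κ₁)) * (π * (ρ₂ / (Real.sqrt 2 * B.umin))) ≤ ρs := by
    rw [← hSE]
    have e : ρ₂ + 2 * SE * (π * (ρ₂ / (Real.sqrt 2 * B.umin))) = ρ₂ * κW := by rw [hκW]; field_simp
    rw [e, hρ₂]
    have h1 : q * κW ≤ ρs := by rw [le_div_iff₀ hκW0] at hq2; exact hq2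
    linarith only [h1, mul_pos hq0 hκW0]
  have hcwin := fun (m : Fin 2 → ℤ) (θ : ℝ)
      (hw' : ∀ i, |2 * (perturbedFermiRadius (fun k : Fin 2 → ℝ => -K.eval k) ν θ • dir θ) i - wv i - m i * (2 * π)| ≤
        ρ₂ + 2 * (B.smax + κ₁ * (π * Real.sqrt 2 + 2 * B.smax) / (B.Dtmin - κ₁)) * (π * (ρ₂ / (Real.sqrt 2 * B.umin)))) =>
    hconv K μ hδ hκ hG ν hlo' hhi' hνμ _ wv m θ hρwin hw'
  rw [← hc] at hcwin
  have hmain := volume_sublevel_le_caustic_of_geomConstants B hδ hκ hκ₁ hG hνlt θ₀ hlo hhi hδη hδ0 hlam0 hδl hfar hR1 hρ₂a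
    hlo hhi hℓ0 hηℓ hR0 hρ₂c hρ₂π hσ hc0 hcwin
  refine hmain.trans (le_of_eq ?_)
  -- `ofReal(3(2π/ℓ+97))·ofReal(δ/λ) + 48·ofReal(6√(δ/c)) = ofReal(C₁δ + C₂√δ)`
  have h1 : ENNReal.ofReal (3 * (2 * π / ℓ + 97)) * ENNReal.ofReal (δ / lam) = ENNReal.ofReal (C₁ * δ) := by
    rw [← ENNReal.ofReal_mul (by positivity), hC₁]; congr 1; field_simp
  have h2 : (48 : ℝ≥0∞) * ENNReal.ofReal (6 * Real.sqrt (δ / c)) = ENNReal.ofReal (C₂ * Real.sqrt δ) := by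
    rw [show (48 : ℝ≥0∞) = ENNReal.ofReal 48 by simp, ← ENNReal.ofReal_mul (by norm_num), hC₂]
    congr 1
    rw [Real.sqrt_div hδ0.le]; field_simp
  rw [h1, h2, ← ENNReal.ofReal_add (by positivity) (by positivity)]

end Summit.HubbardSuperconductivity.HubbardSuperconductivity.Theorems.PerturbedFermiCurve

end
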